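import Literature.MathematicalPhysics.QuantumFieldTheory.Balaban1983to89.B7Ineq148
import Literature.MathematicalPhysics.QuantumFieldTheory.Balaban1983to89.B7Eq123General

/-!
# `Balaban1983to89.B7Ineq148General` — T. Bałaban, *Averaging operations for lattice gauge theories*, Commun. Math. Phys.
**98** (1985) 17–51 [Balaban1985Averaging]: **(148) AT A GENERAL REGULAR BACKGROUND** — «|⟨δC(V₀, A)/δA, δA⟩| ≤ C″₁|A|Q″|δA|»
for the concrete one-step remainder `C(V₀, ·, c)` of (122), read on the insertion space `𝔸^S`

statement-level skeleton of published theorems with citation tags; proofs where landed; nothing here is a claim about the Yang–Mills mass gap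

v1.1 (p06 gen 20, 2026-08-23): DOCFIX ONLY — two cite locators «Proposition 1 (51) p.25» → «p.26» (docstrings of
`ineq148_general_of_pdev`, `analyticOnNhd_Qcov_insCfg_of_pdev`): printed p. 25 [PDF 9] ends with (50) and «We formulate the results in
the following:», Proposition 1 with (51) stands on p. 26 [PDF 10] (text layer `p0010.txt` L1–L5, running head «26 T. Bałaban»; r04
`CITELOC-AUDIT-g22.md` §1–§2, r12 `CITELOC-SWEEP-g14.md` §8); declarations byte-identical.

PDF held: `paper:balaban1985-cmp98-averaging` (journal page = PDF page + 16); pp. 36, 39–40 [PDF 20, 23–24] read on the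
renders `b2b-balaban-ref1/pages/1985-cmp98-averaging/…-p020-x2.png`, `…-p022-x2.png`, `…-p024-x2.png` (AS IMAGES).

CITATION HEADER / WHAT IS REPRODUCED.  SKELETON row **B7.Eq148** («(148) EST: |⟨δC(V₀,A)/δA, δA⟩| ≤ C″₁|A|Q″|δA|»; cell
`lit-balaban`, HOME `run/shared/lean/pub/lit-balaban/`, seat p06 gen 2 = unit `lit-balaban-p06`).  Row status before
this file: the printed implication «(123) + analyticity ⇒ (148)» is KERNEL for an abstract remainder on a finite variable
space (`B7Ineq148.ineq148Printed_of_123`, second-order Cauchy estimate) and (148) is proved at `V₀ = 1`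
(`B7Prop5Flat.ineq148_flat`); at a general background it rested on (123) @gen — now `B7Eq123General.norm_Ccov_le`
(p246433).  p. 40, verbatim: *"Let us consider the second term on the right side of (147). From (122) we get
|⟨δC(V₀, A)/δA, δA⟩| ≤ C″₁|A|Q″|δA| (148) … The constant C″₁ depends on d and L."*; p. 36 (Prop. 3): *"C(V₀, A, c) is an
analytic function of A whose Taylor's expansion begins with a quadratic form and which satisfies |C(V₀, A, c)| < C₁L²|A|²
< C₁L²α₁². (123)"*; p. 39: the pairing (137)–(138) `⟨δF/δA, δA⟩ = (d/dt) F(A + tδA)|_{t=0}` and (140) `(Q″A)_c =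
Σ_{b⊂B(c₋)∪B(c₊)} L^{−d}A_b`.

CARRIERS (REUSED BY NAME): `B7Prop3GeneralLinear.Qcov`/`linQcov`/`Ccov` ((121)/(122)), `B7Prop3Flat.insCfg` (the field
`A = a` on a finite bond set `S`, `0` off `S`; `𝔸^S` with the sup norm is the printed variable space «A_b, b ⊂ B(c₋) ∪
B(c₊)» when `S` is that bond set), `B7Ineq148.dPair` ((137)), `.Qpp` ((140) summed over `S`), `.Ineq148Printed` ((148) as a
property of a function on `𝔸^S` with a stated radius and constant).

WHAT THIS FILE PROVES (kernel, 0 sorry, theorems only), for `V₀` unit-bounded with `α`-regular block loops at the `L`-bond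
`c = (q, κ)` (`α ≤ 1/64`) — in particular (§2) for `pdev V₀ < β ≤ 1/(1024(d+1)(d+4)L²)` ((52) via Prop. 1) —, any finite `S`:
* `analyticOnNhd_Qcov_insCfg` — «C(V₀, A, c) [equivalently Q] is an analytic function of A»: `a ↦ Q(V₀, ins_S a, c)` is
  analytic on the polydisc `‖a‖ < c₃(d, L)` (`B7Prop3GeneralAnalytic.prop3_general_analyticAt_of_le_c3` along `insCfg`);
* `linQcov_insCfg_eq_fderiv` — the linear part through the insertion IS the Fréchet derivative at `0`;
  `differentiableOn_Ccov_insCfg`; `norm_Ccov_insCfg_le` — (123) on `𝔸^S`: `‖C(V₀, ins_S a, c)‖ ≤ C₁L²‖a‖²` for `‖a‖ ≤ c₃`,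
  `C₁ = 131072(d+1)²` (`B7Eq123General.norm_Ccov_le_explicit`);
* **`ineq148_general`** — (148) for `a ↦ C(V₀, ins_S a, c)`: `Ineq148Printed` with radius `c₃(d,L)/2` and `C″₁ = 4C₁L^{d+2}`
  (`B7Ineq148.ineq148Printed_of_123`); **`ineq148_general_of_pdev`** — the same under `pdev V₀ < β ≤ βmax`
  (`B7Eq123General.blockLoops_of_pdev`).  `B7Prop5Flat.ineq148_flat` is the case `V₀ = 1`.
DIVERGENCES from print: `Q″` is summed over the chosen `S` (print: over `b ⊂ B(c₋) ∪ B(c₊)`; `C(V₀, A, c)` depends on no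
other bond, so `S` = that set is the printed letter and a larger `S` only enlarges the right-hand side); radius `c₃/2` and
`C″₁ = 4·131072(d+1)²·L^{d+2}` explicit («C″₁ depends on d and L»); `<` ↦ `≤`; sup bounds global on `ℤᵈ` for `V₀`.
-/

noncomputable section

open Metric Set

namespace Literature.MathematicalPhysics.QuantumFieldTheory.Balaban1983to89.B7Ineq148General

open B7Prop1Explicit B7Prop2Explicit B7Prop3Flat B7Eq92Concrete MatrixLog B7Prop3GeneralLinear B7Prop3GeneralAnalytic
  B7Ineq148 B7Eq123General

-- `Site` alone would resolve to the torus sites of `Setup.lean`; re-export the `ℤ^d` sites of `B7Prop1Explicit`.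
export B7Prop1Explicit (Site)

variable {d : ℕ}
variable {𝔸 : Type*} [NormedRing 𝔸] [NormedAlgebra ℂ 𝔸] [CompleteSpace 𝔸] [NormOneClass 𝔸]

/-! ## §1 (148) at a background with `α`-regular block loops at `c` -/

section Loops

variable {L : ℕ} (hL : 1 ≤ L) {V₀ : Site d → Fin d → 𝔸ˣ} (hV₀ : ∀ x κ, V₀ x κ ∈ U1 𝔸)
  (q : Site d) (κ : Fin d) {α : ℝ} (hα1 : α ≤ 1 / 64)
  (hreg : ∀ r : Fin d → Fin L, ‖((Wcx L V₀ q κ (boxVec L r) : 𝔸ˣ) : 𝔸) - 1‖ ≤ α)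
include hL hV₀ hα1 hreg

/-- **Prop. 3's analyticity through the insertion** — p. 36 «C(V₀, A, c) is an analytic function of A» (equivalently
`Q = LQ(V₀)A + C`): for `V₀` unit-bounded with `α`-regular block loops at `c` and every finite bond set `S`, `a ↦ Q(V₀,
ins_S a, c)` is analytic on a neighbourhood of every point of the polydisc `‖a‖ < c₃(d, L)`
(`prop3_general_analyticAt_of_le_c3` along `insCfg`). [cite: Balaban1985Averaging, Proposition 3 (121) p.36, p.34] -/
theorem analyticOnNhd_Qcov_insCfg (S : Finset (Site d × Fin d)) :
    AnalyticOnNhd ℂ (fun a : S → 𝔸 => Qcov L V₀ (insCfg S a) q κ) (ball 0 (c3 d L)) := fun a₀ ha => by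
  rw [mem_ball_zero_iff] at ha
  show AnalyticAt ℂ (fun a : S → 𝔸 => mlog ((dbavgCov L V₀ (expCfg (insCfg S a)) q κ : 𝔸ˣ) : 𝔸)) a₀
  exact prop3_general_analyticAt_of_le_c3 (fun a : S → 𝔸 => insCfg S a) (fun x μ => analyticAt_insCfg S x μ a₀)
    hL hV₀ (norm_nonneg a₀) (fun x μ => norm_insCfg_le S a₀ x μ) ha.le q κ hα1 hreg

/-- **the linear part through the insertion IS the Fréchet derivative at `0`**: `L(Q(V₀) ins_S a)_c = D[a ↦ Q(V₀, ins_S a,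
c)](0)·a` (the ray `ins_S(ta) = t·ins_S a` and the chain rule; (122) «L(Q(V₀)A)_c» is the first-order Taylor term).
[cite: Balaban1985Averaging, (122) p.36] -/
theorem linQcov_insCfg_eq_fderiv (S : Finset (Site d × Fin d)) (a : S → 𝔸) :
    linQcov L V₀ (insCfg S a) q κ = fderiv ℂ (fun a : S → 𝔸 => Qcov L V₀ (insCfg S a) q κ) 0 a := by
  have hd : DifferentiableAt ℂ (fun a : S → 𝔸 => Qcov L V₀ (insCfg S a) q κ) 0 :=
    (analyticOnNhd_Qcov_insCfg hL hV₀ q κ hα1 hreg S 0 (mem_ball_self (c3_pos d hL))).differentiableAt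
  rw [← dPair_eq_fderiv hd]
  unfold linQcov dPair
  have h : (fun t : ℂ => Qcov L V₀ (t • insCfg S a) q κ)
      = fun t : ℂ => Qcov L V₀ (insCfg S ((0 : S → 𝔸) + t • a)) q κ :=
    funext fun t => by rw [zero_add, insCfg_smul]
  rw [h]

/-- **`a ↦ C(V₀, ins_S a, c)` is `ℂ`-differentiable on the polydisc `‖a‖ < c₃(d, L)`** (analytic `Q` minus its linear
part, which through the insertion is the continuous linear map `D[Q ∘ ins_S](0)`).
[cite: Balaban1985Averaging, Proposition 3 (121)–(122) p.36] -/
theorem differentiableOn_Ccov_insCfg (S : Finset (Site d × Fin d)) :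
    DifferentiableOn ℂ (fun a : S → 𝔸 => Ccov L V₀ (insCfg S a) q κ) (ball 0 (c3 d L)) := by
  have h : (fun a : S → 𝔸 => linQcov L V₀ (insCfg S a) q κ)
      = fun a => fderiv ℂ (fun a : S → 𝔸 => Qcov L V₀ (insCfg S a) q κ) 0 a :=
    funext fun a => linQcov_insCfg_eq_fderiv hL hV₀ q κ hα1 hreg S a
  have hlin : Differentiable ℂ (fun a : S → 𝔸 => linQcov L V₀ (insCfg S a) q κ) := by
    rw [h]; exact (fderiv ℂ (fun a : S → 𝔸 => Qcov L V₀ (insCfg S a) q κ) 0).differentiable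
  show DifferentiableOn ℂ (fun a : S → 𝔸 => Qcov L V₀ (insCfg S a) q κ - linQcov L V₀ (insCfg S a) q κ)
    (ball 0 (c3 d L))
  exact (analyticOnNhd_Qcov_insCfg hL hV₀ q κ hα1 hreg S).differentiableOn.sub hlin.differentiableOn

/-- **(123) ON THE INSERTION SPACE**: `‖C(V₀, ins_S a, c)‖ ≤ C₁L²‖a‖²` for `‖a‖ ≤ c₃(d, L)`, `C₁ = 131072(d+1)²`
(`B7Eq123General.norm_Ccov_le_explicit` at the inserted field, `‖(ins_S a)_b‖ ≤ ‖a‖`). [cite: Balaban1985Averaging, Proposition 3 (123) p.36] -/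
theorem norm_Ccov_insCfg_le (S : Finset (Site d × Fin d)) {a : S → 𝔸} (ha : ‖a‖ ≤ c3 d L) :
    ‖Ccov L V₀ (insCfg S a) q κ‖ ≤ 131072 * ((d : ℝ) + 1) ^ 2 * (L : ℝ) ^ 2 * ‖a‖ ^ 2 :=
  norm_Ccov_le_explicit hL hV₀ (insCfg S a) (norm_nonneg a) (fun x μ => norm_insCfg_le S a x μ) ha q κ hα1 hreg

/-- **(148) AT A GENERAL REGULAR BACKGROUND, ON THE INSERTION SPACE** — p. 40 «|⟨δC(V₀, A)/δA, δA⟩| ≤ C″₁|A|Q″|δA| …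
The constant C″₁ depends on d and L»: for `C = C(V₀, ·, c)` read on `𝔸^S`, ANY finite `S`, any unit-bounded `V₀` with
`α`-regular block loops at `c` (`α ≤ 1/64`): `Ineq148Printed` with radius `c₃(d, L)/2` and `C″₁ = 4·C₁·L^{d+2}`, `C₁ =
131072(d+1)²` — i.e. `‖dC(V₀, ins_S a; δa)(c)‖ ≤ C″₁‖a‖·Σ_{s∈S} L^{−d}‖δa_s‖` for `‖a‖ < c₃/2` (`B7Ineq148.ineq148Printed_of_123`
fed with Prop. 3 @gen; `B7Prop5Flat.ineq148_flat` is the case `V₀ = 1`). [cite: Balaban1985Averaging, (148) p.40, Proposition 3 (121)–(123) p.36] -/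
theorem ineq148_general (S : Finset (Site d × Fin d)) :
    Ineq148Printed (fun a : S → 𝔸 => Ccov L V₀ (insCfg S a) q κ) (L : ℝ) d (c3 d L / 2)
      (4 * (131072 * ((d : ℝ) + 1) ^ 2) * (L : ℝ) ^ (d + 2)) := by
  have hL0 : (0 : ℝ) < L := by exact_mod_cast hL
  exact ineq148Printed_of_123 (d := d) (c₃ := c3 d L) hL0 (by positivity)
    (differentiableOn_Ccov_insCfg hL hV₀ q κ hα1 hreg S)
    (fun a ha => norm_Ccov_insCfg_le hL hV₀ q κ hα1 hreg S (le_of_lt (by rwa [mem_ball_zero_iff] at ha)))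

/-- (148) at a general regular background, DISPLAYED: for `‖a‖ < c₃(d,L)/2` and every `δa ∈ 𝔸^S`,
`‖⟨δC(V₀, ins_S a)/δA, ins_S δa⟩(c)‖ ≤ 4C₁L^{d+2}·‖a‖·(Q″‖δa‖)` (`ineq148_general` unfolded). [cite: Balaban1985Averaging, (148) p.40] -/
theorem norm_dPair_Ccov_insCfg_le (S : Finset (Site d × Fin d)) {a : S → 𝔸} (ha : ‖a‖ < c3 d L / 2) (δa : S → 𝔸) :
    ‖dPair (fun a : S → 𝔸 => Ccov L V₀ (insCfg S a) q κ) a δa‖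
      ≤ 4 * (131072 * ((d : ℝ) + 1) ^ 2) * (L : ℝ) ^ (d + 2) * ‖a‖ * Qpp (L : ℝ) d δa :=
  ineq148_general hL hV₀ q κ hα1 hreg S a ha δa

end Loops

/-! ## §2 (148) under Prop. 2's regime `pdev V₀ < β ≤ βmax` ((52) via Prop. 1) -/

/-- **(148) AT A GENERAL REGULAR BACKGROUND in plaquette currency**: for `V₀` unit-bounded with `pdev V₀ < β ≤
1/(1024(d+1)(d+4)L²)` (then every block loop is `1/64`-regular, `B7Eq123General.blockLoops_of_pdev` = Prop. 1), ANY finite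
`S` and every `L`-bond `c`: `Ineq148Printed` for `a ↦ C(V₀, ins_S a, c)` with radius `c₃(d,L)/2`, `C″₁ = 4·131072(d+1)²·L^{d+2}`.
This is the one-step input «(148)» of the inductions (149)–(155) (`B7Prop5GeneralInduction`) at every level background.
[cite: Balaban1985Averaging, (148) p.40, Proposition 1 (51) p.26, Proposition 3 p.36] -/
theorem ineq148_general_of_pdev {L : ℕ} (hL : 1 ≤ L) {V₀ : Site d → Fin d → 𝔸ˣ} (hV₀ : ∀ x κ, V₀ x κ ∈ U1 𝔸)
    {β : ℝ} (hβ0 : 0 ≤ β) (hβ : pdev V₀ < β)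
    (hβmax : β ≤ 1 / (1024 * ((d : ℝ) + 1) * ((d : ℝ) + 4) * (L : ℝ) ^ 2))
    (S : Finset (Site d × Fin d)) (q : Site d) (κ : Fin d) :
    Ineq148Printed (fun a : S → 𝔸 => Ccov L V₀ (insCfg S a) q κ) (L : ℝ) d (c3 d L / 2)
      (4 * (131072 * ((d : ℝ) + 1) ^ 2) * (L : ℝ) ^ (d + 2)) := by
  obtain ⟨hreg, hα1⟩ := blockLoops_of_pdev hL hV₀ hβ0 hβ hβmax q κ
  exact ineq148_general hL hV₀ q κ hα1 hreg S

/-- the analyticity clause in plaquette currency: `a ↦ Q(V₀, ins_S a, c)` is analytic on `‖a‖ < c₃(d, L)` for `V₀`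
unit-bounded with `pdev V₀ < β ≤ βmax`. [cite: Balaban1985Averaging, Proposition 3 (121) p.36, Proposition 1 (51) p.26] -/
theorem analyticOnNhd_Qcov_insCfg_of_pdev {L : ℕ} (hL : 1 ≤ L) {V₀ : Site d → Fin d → 𝔸ˣ}
    (hV₀ : ∀ x κ, V₀ x κ ∈ U1 𝔸) {β : ℝ} (hβ0 : 0 ≤ β) (hβ : pdev V₀ < β)
    (hβmax : β ≤ 1 / (1024 * ((d : ℝ) + 1) * ((d : ℝ) + 4) * (L : ℝ) ^ 2))
    (S : Finset (Site d × Fin d)) (q : Site d) (κ : Fin d) :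
    AnalyticOnNhd ℂ (fun a : S → 𝔸 => Qcov L V₀ (insCfg S a) q κ) (ball 0 (c3 d L)) := by
  obtain ⟨hreg, hα1⟩ := blockLoops_of_pdev hL hV₀ hβ0 hβ hβmax q κ
  exact analyticOnNhd_Qcov_insCfg hL hV₀ q κ hα1 hreg S

end Literature.MathematicalPhysics.QuantumFieldTheory.Balaban1983to89.B7Ineq148General

end
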